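import Summits.Ventures.AbcSig.Rows.StatementsC1b
import Summits.Ventures.AbcSig.Rows.XnYn59Z2EvenX

/-!
# Venture AbcSig — CELL bridge for `xⁿ + yⁿ = 59 z²` (`xy` even): p1's census predicate `Rows.C1CellEven 59 11 ∅`

HONEST FRAMING. COMPUTATION cell `pub-abcsig`; CONDITIONAL theorem; no claim on ABC or any summit. Hypotheses exactly
those of `Rows/XnYn59Z2EvenX.lean` (`xrow_XnYn59Z2Even`): `BS04Package` (CITED), `DataComplete` / `RefinesCPSymAll` (COMPUTED,
certified engine level files; norm-form certificates `Sieve/CharpolyCert.lean`), and the row's per-orbit CITED exclusions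
`hX_…` universally quantified in the exponent. Conclusion = p1's statement of the SIGNED row of record
`census/rows/C1/C1-C59-even.md` (sha16 `a6e1c3121a82fd52`) in the census vocabulary
(`Rows/Statements.lean`, `Rows/StatementsC1b.lean`). GENERATED by p-lean g4 `gen4/cprow.py` (pattern of `Rows/XnYn14Z2XCell.lean`).
-/

namespace Summit.Ventures.AbcSig

/-- `xⁿ + yⁿ = 59 z²` (`xy` even): p1's `Rows.C1CellEven 59 11 ∅` from `xrow_XnYn59Z2Even` (hypotheses as there, `hX_…` for every exponent). -/
theorem C1CellEven_59_of (M : NewformModel) (hP : M.BS04Package)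
    (hD6962 : M.DataComplete 6962 level6962Orbits) (hCP6962 : M.RefinesCPSymAll 6962 level6962CP)
    (hX_orbit_6962_6 : ∀ n : ℕ, n ∈ ([11] : List ℕ) → M.Excludes 6962 orbit_6962_6 (fun S => S.A = 1 ∧ S.B = 1 ∧ S.C = 59 ∧ S.n = n ∧ 2 ∣ S.a * S.b))
    (hX_orbit_6962_37 : ∀ n : ℕ, n ∈ ([29] : List ℕ) → M.Excludes 6962 orbit_6962_37 (fun S => S.A = 1 ∧ S.B = 1 ∧ S.C = 59 ∧ S.n = n ∧ 2 ∣ S.a * S.b))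
    (hX_orbit_6962_38 : ∀ n : ℕ, n ∈ ([29] : List ℕ) → M.Excludes 6962 orbit_6962_38 (fun S => S.A = 1 ∧ S.B = 1 ∧ S.C = 59 ∧ S.n = n ∧ 2 ∣ S.a * S.b)) :
    Rows.C1CellEven 59 11 ∅ := by
  intro n hn h11 hC _ x y z hpar
  exact xrow_XnYn59Z2Even M hP hD6962 hCP6962 n hn h11  hC (hX_orbit_6962_6 n) (hX_orbit_6962_37 n) (hX_orbit_6962_38 n) x y z hpar

end Summit.Ventures.AbcSig
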